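import Summits.AtomisticToContinuum.HydrodynamicLimit.Theorems.JParityClosureOddContactSymmetryGibbsInvariance
import Summits.AtomisticToContinuum.HydrodynamicLimit.Theorems.JParityClosureOddContactSymmetryL2ToProbability
import HarnessLib

/-!
# One-sided Markov transfer along the flow at rung 0 (helper file, `--supports stmt-AtomisticToContinuum-13080`)

Crux `JParityClosure.RateFloor` (stmt-AtomisticToContinuum-13080), line `Sketch`, rung-0 stub `stub_staticOpacityFloorRung0`: the
device that turns a STATIC first-moment bound into an in-probability UPPER bound for a time-integrated nonnegative functional along
the flow — the one-sided, first-moment twin of the two-sided `measure_lt_abs_setIntegral_flow_le` (mean + variance, Chebyshev) of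
`JParityClosureOddContactSymmetryL2ToProbability`.  For constant profiles the local Gibbs law `G_N` is `Φ_t`-invariant
(`lintegral_comp_flow_localGibbsLaw_const`), so for a jointly measurable `A ≥ 0` with static means `∫ A_t dG_N ≤ m` on `[0, τ]`:

  `G_N {z | η < ∫_{[0,τ]} A_t (Φ_t z) dt} ≤ (τ m)/η`   (`measure_lt_setIntegral_flow_le_of_nonneg`),

by Tonelli on the jointly measurable extension `A_t (good.piecewise Φ_t id z)` (`measurable_piecewise_flow_torus`; `G_N`-a.e. `z` is
good), invariance at each `t`, and Markov's inequality (`meas_ge_le_lintegral_div`).  No integrability of `t ↦ A_t(Φ_t z)` is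
assumed: where the Bochner time integral is junk (`0`) the event is empty.
-/

noncomputable section

open MeasureTheory ProbabilityTheory Set Filter Topology
open scoped ENNReal BigOperators

namespace Summit.AtomisticToContinuum.HydrodynamicLimit.Theorems

namespace RateFloorMarkovFlowTransfer

open Literature.Analysis.FluidPDE Literature.MathematicalPhysics.KineticTheory

/-- A real Bochner integral of a nonnegative function is at most the `toReal` of the corresponding lower integral, and
if `η < ∫ f` (`η ≥ 0`) then `ofReal η < ∫⁻ ofReal ∘ f`. [folklore] -/
theorem ofReal_lt_lintegral_of_lt_integral {α : Type*} [MeasurableSpace α] {μ : Measure α} {f : α → ℝ}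
    (hf0 : ∀ x, 0 ≤ f x) {η : ℝ} (hη : 0 ≤ η) (h : η < ∫ x, f x ∂μ) :
    ENNReal.ofReal η < ∫⁻ x, ENNReal.ofReal (f x) ∂μ := by
  have hpos : 0 < ∫ x, f x ∂μ := hη.trans_lt h
  have hint : Integrable f μ := by
    by_contra hni
    rw [integral_undef hni] at hpos
    exact lt_irrefl _ hpos
  rw [integral_eq_lintegral_of_nonneg_ae (ae_of_all _ hf0) hint.aestronglyMeasurable] at h
  have hfin : ∫⁻ x, ENNReal.ofReal (f x) ∂μ ≠ ∞ := hint.lintegral_lt_top.ne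
  rw [← ENNReal.ofReal_toReal hfin]
  exact (ENNReal.ofReal_lt_ofReal_iff (hη.trans_lt h)).2 h

/-- **One-sided Markov transfer along the flow at rung 0.**  Constant profiles `a, θ > 0`, `u`, `σ ≤ 1/2` (so that `G_N` is a
probability measure), a flow `Φ`, `τ > 0`, `η > 0`, `m` real, and `A : ℝ → Config → ℝ` jointly measurable, nonnegative, with STATIC
means `∫⁻ ofReal (A t z) dG_N ≤ ofReal m` for `t ∈ [0, τ]`.  Then
`G_N {z | η < ∫_{t ∈ [0,τ]} A t (Φ.flow t z)} ≤ ofReal (τ m / η)`. [folklore] -/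
theorem measure_lt_setIntegral_flow_le_of_nonneg (σ : ℝ) {a θ : ℝ} (ha : 0 < a) (hθ : 0 < θ) (u : V3) (hσ2 : σ ≤ 1 / 2)
    (N : ℕ) (Φ : HardSphereFlow (Torus.geometry (Fin 3)) (hsDiameter σ N) (N + 1))
    {A : ℝ → Config (N + 1) (Fin 3) T3 → ℝ} (hmeas : Measurable fun p : ℝ × Config (N + 1) (Fin 3) T3 => A p.1 p.2)
    (hA0 : ∀ t z, 0 ≤ A t z) {τ η m : ℝ} (hτ : 0 < τ) (hη : 0 < η)
    (hmean : ∀ t ∈ Icc (0 : ℝ) τ,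
      ∫⁻ z, ENNReal.ofReal (A t z) ∂(localGibbsLaw σ (fun _ => a) (fun _ => u) (fun _ => θ) N Φ) ≤ ENNReal.ofReal m) :
    localGibbsLaw σ (fun _ => a) (fun _ => u) (fun _ => θ) N Φ
        {z | η < ∫ t in Icc (0 : ℝ) τ, A t (Φ.flow t z)} ≤ ENNReal.ofReal (τ * m / η) := by
  classical
  set G := localGibbsLaw σ (fun _ => a) (fun _ => u) (fun _ => θ) N Φ with hG
  haveI : IsProbabilityMeasure G := isProbabilityMeasure_localGibbsLaw continuous_const continuous_const continuous_const
    (fun _ => ha) (fun _ => hθ) hσ2 N Φ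
  -- `G`-a.e. configuration is good
  have hgood : ∀ᵐ z ∂G, z ∈ Φ.good := by
    rw [hG, localGibbsLaw_eq]
    exact (localGibbsMeasure_absolutelyContinuous σ _ _ _ N Φ).ae_le Φ.ae_mem_good
  -- the jointly measurable extension
  set Y : ℝ × Config (N + 1) (Fin 3) T3 → ℝ≥0∞ := fun p => ENNReal.ofReal (A p.1 (Φ.good.piecewise (Φ.flow p.1) id p.2)) with hY
  have hYm : Measurable Y :=
    (hmeas.comp (measurable_fst.prodMk (measurable_piecewise_flow_torus Φ))).ennreal_ofReal
  have hYeq : ∀ z ∈ Φ.good, ∀ t, Y (t, z) = ENNReal.ofReal (A t (Φ.flow t z)) := fun z hz t => by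
    simp only [hY, piecewise_flow_of_mem Φ t hz]
  -- time measure
  set ν : Measure ℝ := volume.restrict (Icc (0 : ℝ) τ) with hν
  haveI : IsFiniteMeasure ν := by rw [hν]; infer_instance
  have hνmass : ν univ = ENNReal.ofReal τ := by
    rw [hν, Measure.restrict_apply_univ, Real.volume_Icc, sub_zero]
  -- the time-integrated majorant `F z = ∫⁻ Y(t, z) dν(t)`
  set F : Config (N + 1) (Fin 3) T3 → ℝ≥0∞ := fun z => ∫⁻ t, Y (t, z) ∂ν with hF
  have hFm : Measurable F := hYm.lintegral_prod_left'
  -- (1) the event is contained in `{ofReal η ≤ F}` on the good set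
  have hsub : ∀ᵐ z ∂G, η < ∫ t in Icc (0 : ℝ) τ, A t (Φ.flow t z) → ENNReal.ofReal η ≤ F z := by
    filter_upwards [hgood] with z hz h
    have h1 := ofReal_lt_lintegral_of_lt_integral (μ := ν) (fun t => hA0 t (Φ.flow t z)) hη.le h
    refine h1.le.trans (le_of_eq ?_)
    simp only [hF]
    exact lintegral_congr fun t => (hYeq z hz t).symm
  -- (2) Tonelli and invariance: `∫⁻ F dG ≤ τ m`
  have hFint : ∫⁻ z, F z ∂G ≤ ENNReal.ofReal τ * ENNReal.ofReal m := by
    have hswap : ∫⁻ z, F z ∂G = ∫⁻ t, ∫⁻ z, Y (t, z) ∂G ∂ν := by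
      simp only [hF]
      exact lintegral_lintegral_swap (hYm.comp measurable_swap).aemeasurable
    rw [hswap]
    have hinner : ∀ t ∈ Icc (0 : ℝ) τ, ∫⁻ z, Y (t, z) ∂G ≤ ENNReal.ofReal m := by
      intro t ht
      have hae : (fun z => Y (t, z)) =ᵐ[G] fun z => ENNReal.ofReal (A t (Φ.flow t z)) :=
        hgood.mono fun z hz => hYeq z hz t
      have hgm : Measurable fun z : Config (N + 1) (Fin 3) T3 => ENNReal.ofReal (A t z) :=
        (hmeas.comp (measurable_const.prodMk measurable_id)).ennreal_ofReal
      have hinv : ∫⁻ z, ENNReal.ofReal (A t (Φ.flow t z)) ∂G = ∫⁻ z, ENNReal.ofReal (A t z) ∂G :=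
        lintegral_comp_flow_localGibbsLaw_const σ a θ u N Φ t hgm
      rw [lintegral_congr_ae hae, hinv]
      exact hmean t ht
    have hS : ∀ᵐ t ∂ν, t ∈ Icc (0 : ℝ) τ := by rw [hν]; exact ae_restrict_mem measurableSet_Icc
    calc ∫⁻ t, ∫⁻ z, Y (t, z) ∂G ∂ν ≤ ∫⁻ _t, ENNReal.ofReal m ∂ν :=
          lintegral_mono_ae (hS.mono fun t ht => hinner t ht)
      _ = ENNReal.ofReal m * ν univ := lintegral_const _
      _ = ENNReal.ofReal τ * ENNReal.ofReal m := by rw [hνmass, mul_comm]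
  -- (3) Markov
  have hη' : ENNReal.ofReal η ≠ 0 := (ENNReal.ofReal_pos.2 hη).ne'
  calc G {z | η < ∫ t in Icc (0 : ℝ) τ, A t (Φ.flow t z)}
      ≤ G {z | ENNReal.ofReal η ≤ F z} := measure_mono_ae (hsub.mono fun z hz h => hz h)
    _ ≤ (∫⁻ z, F z ∂G) / ENNReal.ofReal η := meas_ge_le_lintegral_div hFm.aemeasurable hη' ENNReal.ofReal_ne_top
    _ ≤ (ENNReal.ofReal τ * ENNReal.ofReal m) / ENNReal.ofReal η := ENNReal.div_le_div_right hFint _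
    _ = ENNReal.ofReal (τ * m / η) := by
        rw [← ENNReal.ofReal_mul hτ.le, ENNReal.ofReal_div_of_pos hη]

/-- **Registered helper stub `stub_markovFlowTransferRung0`** of crux stmt-AtomisticToContinuum-13080 (line `Sketch`, input of
`stub_staticOpacityFloorRung0`): the one-sided Markov transfer along the flow at rung 0, in closed signature form
(= `measure_lt_setIntegral_flow_le_of_nonneg`). [folklore] -/
theorem stub_markovFlowTransferRung0 : ∀ (σ a θ : ℝ) (u : V3), 0 < a → 0 < θ → σ ≤ 1 / 2 → ∀ (N : ℕ) (Φ : HardSphereFlow (Torus.geometry (Fin 3)) (hsDiameter σ N) (N + 1)) (A : ℝ → Config (N + 1) (Fin 3) T3 → ℝ), Measurable (fun p : ℝ × Config (N + 1) (Fin 3) T3 => A p.1 p.2) → (∀ t z, 0 ≤ A t z) → ∀ (τ η m : ℝ), 0 < τ → 0 < η → (∀ t ∈ Set.Icc (0 : ℝ) τ, ∫⁻ z, ENNReal.ofReal (A t z) ∂(localGibbsLaw σ (fun _ => a) (fun _ => u) (fun _ => θ) N Φ) ≤ ENNReal.ofReal m) → localGibbsLaw σ (fun _ => a) (fun _ =>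 u) (fun _ => θ) N Φ {z | η < ∫ t in Set.Icc (0 : ℝ) τ, A t (Φ.flow t z)} ≤ ENNReal.ofReal (τ * m / η) :=
  fun σ _a _θ u ha hθ hσ2 N Φ _A hmeas hA0 _τ _η _m hτ hη hmean =>
    measure_lt_setIntegral_flow_le_of_nonneg σ ha hθ u hσ2 N Φ hmeas hA0 hτ hη hmean

end RateFloorMarkovFlowTransfer

end Summit.AtomisticToContinuum.HydrodynamicLimit.Theorems

end
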